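import Literature.AlgebraicGeometry.HodgeTheory.HodgeGroupProductCMFactorClasses
import HarnessLib

/-!
# Moonen–Zarhin 1999, Thm. 0.1, for simple abelian fourfolds with non-commutative endomorphism ring

B. Moonen, Yu. Zarhin, *Hodge classes on abelian varieties of low dimension*, Math. Ann. 315 (1999) 711–733
(arXiv:math/9901113), Theorem 0.1 [corpus:paper:arxiv-math_9901113 p0001 L77–L121]. For a complex abelian variety `X`
with `dim X ≤ 4` the theorem singles out four special cases — (a) `X ∼ X₁ × X₂` with `X₁` a CM elliptic curve,
`k ↪ End⁰(X₂)`; (b) `X` simple of dimension 4, `End⁰(X)` a FIELD containing an imaginary quadratic `k` acting with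
multiplicities `(2,2)`; (c) `X` simple of dimension 4 with `D = End⁰(X)` a DEFINITE QUATERNION ALGEBRA over `ℚ`
(Albert type III(1)); (d) `X` simple of dimension 4 with `End⁰(X) = ℚ` — and states: "(4) Suppose we are not in one
of the cases (a), (b), (c) or (d). Then `Hg(X) = Sp_D(V,φ)` and `B•(Xⁿ) = D•(Xⁿ)` for all `n`."

This file records the theorem READ FOR A SIMPLE FOURFOLD WITH NON-COMMUTATIVE ENDOMORPHISM RING, on the tree's carriers:
(a) is excluded by simplicity and (b), (d) by non-commutativity, so such an `X` is EITHER in case (c) — and a definite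
quaternion algebra `D = (α, β)_ℚ` (`α, β < 0`) has standard anticommuting generators `i, j` (`i² = α`, `j² = β`,
`ij = -ji`) which, multiplied by a common denominator, are endomorphisms `φ, ψ ∈ End X` with `φ ≫ φ = -(d • 𝟙)`,
`ψ ≫ ψ = -(e • 𝟙)`, `d, e ∈ ℤ_{≥1}`, `φ ≫ ψ = -(ψ ≫ φ)` — OR in case (4): every power `Xⁿ`, `n ≥ 1`, has a
divisor-generated Hodge ring, `HodgeTheory.IsDivisorGenerated (X.powSucc N)` (van Geemen, LNM 1594, 2.4–2.5: `B = D`).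
One named fact (D-0014), not proved in the tree; consumers take it as a hypothesis
(`Summits/HodgeConjecture/HodgeConjecture/Theorems/Ring2AbelianAllTypeIIIFourfoldsPrint`: with Floccari–Fu 2026 it
gives the Hodge conjecture for all powers of every simple abelian fourfold with non-commutative endomorphism ring).

## References

* [MoonenZarhin1999LowDim] B. Moonen, Yu. G. Zarhin, Hodge classes on abelian varieties of low dimension, Math. Ann.
  315 (1999), no. 4, 711–733; arXiv:math/9901113 — Thm. 0.1 (cases (a)–(d), parts (2) and (4)).
* [vanGeemen1994HodgeAV] B. van Geemen, An introduction to the Hodge conjecture for abelian varieties, LNM 1594 (1994),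
  2.4–2.5 (`B•`, `D•`).
* [MumfordAV1970] D. Mumford, Abelian Varieties (1970), §19 (`End⁰(X) = End(X) ⊗ ℚ`; Cor. 2 of Thm. 1), §21
  (definite quaternion algebras, type III).
-/

noncomputable section

open CategoryTheory

namespace Literature.AlgebraicGeometry.HodgeTheory

open Literature.AlgebraicGeometry.Motives

/-- **Moonen–Zarhin 1999, Thm. 0.1 (cases (a)–(d) and part (4)), for a simple abelian fourfold with non-commutative
endomorphism ring.** Let `X` be a SIMPLE complex abelian variety of dimension `4` whose endomorphism ring is not
commutative (`∃ ψ χ, ψ ≫ χ ≠ χ ≫ ψ`). Then EITHER every power `X^{N+1}` has a divisor-generated Hodge ring,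
`B•(Xⁿ) = D•(Xⁿ)` for all `n ≥ 1` (part (4): the special cases (a) — `X` isogenous to a product, excluded by
simplicity —, (b), (d) — `End⁰(X)` a field resp. `ℚ`, excluded by non-commutativity — and (c) all fail), OR case (c)
holds: `End⁰(X)` is a definite quaternion algebra `(α, β)_ℚ` over `ℚ`, `α, β < 0`, whose standard anticommuting
generators, cleared of denominators, are endomorphisms `φ, ψ` of `X` with `φ ≫ φ = -(d • 𝟙 X)`, `ψ ≫ ψ = -(e • 𝟙 X)`
for some integers `d, e ≥ 1` and `φ ≫ ψ = -(ψ ≫ φ)`. Named fact (D-0014; refereed), stated on the tree's carriers;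
not proved here.
-- TODO(general form): part (4) also covers the non-simple and the commutative fourfolds outside (a), (b), (d), and
-- asserts `Hg(X) = Sp_D(V,φ)`; part (2) describes `B•(X)` in case (c). Only the simple non-commutative dichotomy
-- is recorded.
[cite: MoonenZarhin1999LowDim, Thm. 0.1 (cases (a)–(d) and part (4))] -/
def MoonenZarhin1999_simpleFourfold_noncommutative_divisorGenerated_or_quaternion : Prop :=
  ∀ (A : AbelianVariety ℂ), A.dim = 4 → A.IsSimple → (∃ ψ χ : A ⟶ A, ψ ≫ χ ≠ χ ≫ ψ) →
    (∀ N : ℕ, IsDivisorGenerated (A.powSucc N)) ∨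
      ∃ (φ ψ : A ⟶ A) (d e : ℕ), 0 < d ∧ 0 < e ∧ φ ≫ φ = -(d • 𝟙 A) ∧ ψ ≫ ψ = -(e • 𝟙 A) ∧
        φ ≫ ψ = -(ψ ≫ φ)

end Literature.AlgebraicGeometry.HodgeTheory

end
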